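/-
Copyright (c) 2026. All rights reserved.
Released under Apache 2.0 license as described in the file LICENSE.
Authors: abc-iut cell, seat abc-iut-L4-t9 (gen 5; [AbsTopIII] Def 3.1 (iii) / Prop 3.2 (iv)(v), functor level).
-/
import Literature.AnabelianGeometry.AbsoluteAnabelian.MLFGaloisIntegersFunctor
import Literature.AnabelianGeometry.AbsoluteAnabelian.MonoidKummerMapsIdRigidProofs
import Mathlib.CategoryTheory.Functor.FullyFaithful
import Mathlib.CategoryTheory.EssentialImage

/-!
# The natural functor `𝒞^MLF_TF → 𝒞^MLF_TM` of [AbsTopIII] Def 3.1 (iii) is FAITHFUL, CONSERVATIVE and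
# ESSENTIALLY SURJECTIVE onto pairs with compact Galois group; `𝒞^MLF_TM → 𝒞^MLF_TLG` is faithful

S. Mochizuki, *Topics in absolute anabelian geometry III* [MochizukiAbsTopIII2015] (kurims manuscript
`paper:url-5493eb38cbb7`, read on the page).  Def 3.1 (iii) p. 68: "we thus obtain natural functors
`𝒞^MLF_TF → 𝒞^MLF_TM`; `𝒞^MLF_TM → 𝒞^MLF_TLG`; [...] — i.e., by taking the multiplicative group of nonzero
integral elements [...], the associated groupification `M^gp` of the arithmetic data `M`".  Prop 3.2 (v)
p. 72 l. 29–42: "The algorithm of (iii) yields a natural [1-]factorization `𝒞^{MLF-sB}_TF ⟶ 𝒞^{MLF-sB}_T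
⟶^{𝔩𝔬𝔤_{T,T′}} 𝒞^{MLF-sB}_{T′}` [...] Moreover, the functor `𝔩𝔬𝔤_{T,T}` is isomorphic to the identity functor
[hence, in particular, is an equivalence of categories]" — for `T = TM` this says that "the algorithm of
(iii)" (Cor 1.10 (h): the additive structure reconstructed from `(Π ↷ 𝒪^⊳)` of strictly Belyi type) is a
quasi-inverse of the natural functor `𝒞_TF → 𝒞_TM` on the strictly-Belyi-type pairs.

Sub-DAG row P32.v.L18 (functor level) of `plan/L4/SUBDAG-AbsTopIII-Prop32.md`.  This PROOF-ONLY file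
isolates what the kernel proves UNCONDITIONALLY about abc-iut-L4-t2's real functor `tfToTM`
(`MLFGaloisIntegersFunctor.lean`, on MLF-Galois `TF`-pairs with compact `Π`) towards that equivalence:

* `tfToTM_map_injective` / `tfToTM_faithful` — FAITHFUL: a morphism of `TF`-pairs is determined by `φ_Π`
  and `φ_M|_{𝒪^⊳}` (`M = Frac 𝒪^⊳`: every `x ≠ 0` has `x ∈ 𝒪^⊳` or `x⁻¹ ∈ 𝒪^⊳`,
  `mem_intrinsicNonzeroIntegers_or_inv_mem`);
* `isIso_of_isIso_tfToTM_map` — CONSERVATIVE: if `(φ_Π, φ_M|_{𝒪^⊳})` is an isomorphism of `TM`-pairs then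
  `φ` is an isomorphism of `TF`-pairs (`φ_M` is then a bijective ring homomorphism, same dichotomy);
* `exists_iso_tfToTM_obj` — ESSENTIALLY SURJECTIVE onto MLF-Galois `TM`-pairs with compact `Π`: every such
  pair is isomorphic to the integers of a `TF`-pair with compact `Π` (Def 3.1 (ii): it is isomorphic to a
  model `(Π_k ↷ 𝒪_k̄^⊳)`, which IS the integers of `(Π_k ↷ k̄)`, `isoIntegersOfModel`);
* `tmToTLG_map_injective` / `tmToTLG_faithful` — `(Π ↷ M) ↦ (Π ↷ M^gp)` is faithful (`M ↪ M^gp`).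

Consequently the ONLY missing ingredient for `𝒞_TF → 𝒞_TM` to be an EQUIVALENCE on a class of pairs with
compact `Π` is FULLNESS there — "every morphism `(Π ↷ 𝒪^⊳) → (Π′ ↷ 𝒪′^⊳)` extends to the fields" —
which for pairs of strictly Belyi type is the functoriality of the algorithm of Prop 3.2 (iii) = Cor 1.10 (h)
(campaign-L; NOT asserted here; for mono-analytic pairs `Π = G_k` it FAILS in general — `G_k` has
automorphisms not arising from field automorphisms).  HONEST FRAMING: refereed pre-IUT material; our
kernel theorems about the cell's typed Def 3.1; nothing here bears on [IUTchIII] Cor 3.12 or takes a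
side; typed ≠ proved for anything downstream.
-/

set_option autoImplicit false

noncomputable section

universe u

namespace Literature.AnabelianGeometry.AbsoluteAnabelian

open _root_.CategoryTheory Algebra
open Literature.AlgebraicGeometry.Frobenioids (gpMap gpMap_of)

/-! ## `𝒞_TF → 𝒞_TM` is faithful -/

namespace GaloisFieldPair

variable {P Q : GaloisFieldPair.{u}}

/-- A ring homomorphism out of the field of an MLF-Galois `TF`-pair is determined by its values on the
intrinsic `𝒪^⊳` (every `x ≠ 0` has `x ∈ 𝒪^⊳` or `x⁻¹ ∈ 𝒪^⊳`). [cite: MochizukiAbsTopIII2015, Definition 3.1 (iii) p.68] -/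
theorem ringHom_eq_of_eqOn_intrinsicNonzeroIntegers (hP : IsMLFGaloisFieldPair P) {R : Type*} [DivisionRing R]
    {f g : P.M →+* R} (h : ∀ m : P.M, m ∈ P.intrinsicNonzeroIntegers hP → f m = g m) : f = g := by
  refine RingHom.ext fun x => ?_
  rcases eq_or_ne x 0 with rfl | hx0
  · rw [map_zero, map_zero]
  rcases mem_intrinsicNonzeroIntegers_or_inv_mem hP hx0 with hx | hx
  · exact h x hx
  · have h1 := h x⁻¹ hx
    rw [map_inv₀, map_inv₀] at h1
    exact inv_injective h1

/-- **Two morphisms of MLF-Galois `TF`-pairs with the same `φ_Π` and the same restriction `φ_M|_{𝒪^⊳}` are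
equal.** [cite: MochizukiAbsTopIII2015, Definition 3.1 (iii) p.68] -/
theorem Hom.eq_of_integers_eq (hP : IsMLFGaloisFieldPair P) (hQ : IsMLFGaloisFieldPair Q) {φ ψ : P.Hom Q}
    (hφ : ∀ U : Subgroup P.Pi, IsOpen (U : Set P.Pi) → (U.map φ.homPi ⊔ Q.actionKer).FiniteIndex)
    (hψ : ∀ U : Subgroup P.Pi, IsOpen (U : Set P.Pi) → (U.map ψ.homPi ⊔ Q.actionKer).FiniteIndex)
    (h : φ.integers hP hQ hφ = ψ.integers hP hQ hψ) : φ = ψ := by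
  have hPi : (φ.integers hP hQ hφ).homPi = (ψ.integers hP hQ hψ).homPi := by rw [h]
  refine GaloisFieldPair.Hom.ext hPi (ringHom_eq_of_eqOn_intrinsicNonzeroIntegers hP fun m hm => ?_)
  have h1 : ((φ.integers hP hQ hφ).homM ⟨m, hm⟩ : Q.M) = ((ψ.integers hP hQ hψ).homM ⟨m, hm⟩ : Q.M) := by
    rw [h]
  exact h1

end GaloisFieldPair

/-- **`𝒞^MLF_TF → 𝒞^MLF_TM` is injective on morphisms.** [cite: MochizukiAbsTopIII2015, Definition 3.1 (iii) p.68] -/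
theorem tfToTM_map_injective {P Q : MLFGaloisFieldPairCompactCat.{u}} :
    Function.Injective (tfToTM.map : (P ⟶ Q) → (tfToTM.obj P ⟶ tfToTM.obj Q)) := by
  intro φ ψ h
  have h' := congrArg InducedCategory.Hom.hom h
  apply InducedCategory.hom_ext
  haveI := Q.property.2
  exact GaloisFieldPair.Hom.eq_of_integers_eq (P := P.obj) (Q := Q.obj) P.property.1 Q.property.1
    (fun U hU => GaloisFieldPair.Hom.finiteIndex_sat_of_compactSpace (P := P.obj) (Q := Q.obj) φ.hom U hU)
    (fun U hU => GaloisFieldPair.Hom.finiteIndex_sat_of_compactSpace (P := P.obj) (Q := Q.obj) ψ.hom U hU) h'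

/-- **Def 3.1 (iii) / Prop 3.2 (iv)–(v), functor level: `𝒞^MLF_TF → 𝒞^MLF_TM` is FAITHFUL.**
[cite: MochizukiAbsTopIII2015, Proposition 3.2 (v) p.72] -/
theorem tfToTM_faithful : tfToTM.{u}.Faithful := ⟨fun {_ _} => tfToTM_map_injective⟩

/-! ## `𝒞_TF → 𝒞_TM` is conservative -/

namespace GaloisFieldPair

variable {P Q : GaloisFieldPair.{u}}

/-- If `φ_M|_{𝒪^⊳} : 𝒪^⊳_P → 𝒪^⊳_Q` is surjective then the ring homomorphism `φ_M` is surjective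
(`M_Q = Frac 𝒪^⊳_Q`). [cite: MochizukiAbsTopIII2015, Definition 3.1 (iii) p.68] -/
theorem Hom.homM_surjective_of_integers (hP : IsMLFGaloisFieldPair P) (hQ : IsMLFGaloisFieldPair Q) (φ : P.Hom Q)
    (h : ∀ y : Q.M, y ∈ Q.intrinsicNonzeroIntegers hQ → ∃ m : P.M, m ∈ P.intrinsicNonzeroIntegers hP ∧ φ.homM m = y) :
    Function.Surjective φ.homM := by
  intro y
  rcases eq_or_ne y 0 with rfl | hy0
  · exact ⟨0, map_zero _⟩
  rcases mem_intrinsicNonzeroIntegers_or_inv_mem hQ hy0 with hy | hy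
  · obtain ⟨m, -, hm⟩ := h y hy
    exact ⟨m, hm⟩
  · obtain ⟨m, -, hm⟩ := h y⁻¹ hy
    exact ⟨m⁻¹, by rw [map_inv₀, hm, inv_inv]⟩

end GaloisFieldPair

/-- **Def 3.1 (iii) / Prop 3.2 (v), functor level: `𝒞^MLF_TF → 𝒞^MLF_TM` REFLECTS ISOMORPHISMS** — if
`(φ_Π, φ_M|_{𝒪^⊳})` is an isomorphism of `TM`-pairs, `φ` is an isomorphism of `TF`-pairs.
[cite: MochizukiAbsTopIII2015, Proposition 3.2 (v) p.72] -/
theorem isIso_of_isIso_tfToTM_map {P Q : MLFGaloisFieldPairCompactCat.{u}} (φ : P ⟶ Q)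
    [h : IsIso (tfToTM.map φ)] : IsIso φ := by
  obtain ⟨ψ, h₁, h₂⟩ := h.out
  have h₁' := congrArg InducedCategory.Hom.hom h₁
  have h₂' := congrArg InducedCategory.Hom.hom h₂
  haveI := Q.property.2
  have hP := P.property.1
  have hQ := Q.property.1
  let hφ : ∀ U : Subgroup P.obj.Pi, IsOpen (U : Set P.obj.Pi) →
      (U.map (GaloisFieldPair.Hom.homPi (P := P.obj) (Q := Q.obj) φ.hom) ⊔ Q.obj.actionKer).FiniteIndex :=
    fun U hU => GaloisFieldPair.Hom.finiteIndex_sat_of_compactSpace (P := P.obj) (Q := Q.obj) φ.hom U hU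
  -- the inverse at the level of integers, as a morphism of `TM`-pairs
  let χ : (Q.obj.integersPair hQ).Hom (P.obj.integersPair hP) := ψ.hom
  have h₁χ : GaloisMonoidPair.Hom.comp
      (GaloisFieldPair.Hom.integers (P := P.obj) (Q := Q.obj) φ.hom hP hQ hφ) χ = GaloisMonoidPair.Hom.id _ := h₁'
  have h₂χ : GaloisMonoidPair.Hom.comp χ
      (GaloisFieldPair.Hom.integers (P := P.obj) (Q := Q.obj) φ.hom hP hQ hφ) = GaloisMonoidPair.Hom.id _ := h₂'
  have hPi₁ := congrArg GaloisMonoidPair.Hom.homPi h₁χ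
  have hPi₂ := congrArg GaloisMonoidPair.Hom.homPi h₂χ
  -- `φ_M` is a bijective ring homomorphism (`M_Q = Frac 𝒪^⊳_Q` and `φ_M|_{𝒪^⊳}` is onto `𝒪^⊳_Q`)
  have hsurj : Function.Surjective (GaloisFieldPair.Hom.homM (P := P.obj) (Q := Q.obj) φ.hom) :=
    GaloisFieldPair.Hom.homM_surjective_of_integers (P := P.obj) (Q := Q.obj) hP hQ φ.hom fun y hy =>
      ⟨(χ.homM ⟨y, hy⟩ : P.obj.M), (χ.homM ⟨y, hy⟩).2,
        congrArg (fun ω : (Q.obj.integersPair hQ).Hom (Q.obj.integersPair hQ) => (ω.homM ⟨y, hy⟩ : Q.obj.M)) h₂χ⟩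
  let e : P.obj.M ≃+* Q.obj.M :=
    RingEquiv.ofBijective (GaloisFieldPair.Hom.homM (P := P.obj) (Q := Q.obj) φ.hom)
      ⟨(GaloisFieldPair.Hom.homM (P := P.obj) (Q := Q.obj) φ.hom).injective, hsurj⟩
  have hg : ∀ g : Q.obj.Pi, GaloisFieldPair.Hom.homPi (P := P.obj) (Q := Q.obj) φ.hom (χ.homPi g) = g :=
    fun g => congrArg (fun ω : (Q.obj.integersPair hQ).Hom (Q.obj.integersPair hQ) => ω.homPi g) h₂χ
  -- the inverse morphism of `TF`-pairs `(χ_Π, φ_M⁻¹)`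
  let ω : GaloisFieldPair.Hom Q.obj P.obj :=
    { homPi := χ.homPi
      continuous_homPi := χ.continuous_homPi
      homM := e.symm.toRingHom
      smul_comm := fun g y => by
        apply e.injective
        change e (e.symm (g • y)) = GaloisFieldPair.Hom.homM (P := P.obj) (Q := Q.obj) φ.hom (χ.homPi g • e.symm y)
        rw [RingEquiv.apply_symm_apply, GaloisFieldPair.Hom.smul_comm, hg]
        exact congrArg (g • ·) (e.apply_symm_apply y).symm
      comap_ker := by
        have hk := χ.comap_ker
        rwa [GaloisFieldPair.actionKer_integersPair hP, GaloisFieldPair.actionKer_integersPair hQ] at hk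
      isOpen_image := fun U hU => by
        have ho := χ.isOpen_image U hU
        rwa [GaloisFieldPair.actionKer_integersPair hP] at ho }
  refine ⟨InducedCategory.homMk ω, ?_, ?_⟩
  · apply InducedCategory.hom_ext
    refine GaloisFieldPair.Hom.ext ?_ (RingHom.ext fun x => ?_)
    · exact hPi₁
    · exact e.symm_apply_apply x
  · apply InducedCategory.hom_ext
    refine GaloisFieldPair.Hom.ext ?_ (RingHom.ext fun y => ?_)
    · exact hPi₂
    · exact e.apply_symm_apply y

/-- `𝒞^MLF_TF → 𝒞^MLF_TM` reflects isomorphisms (class form of `isIso_of_isIso_tfToTM_map`).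
[cite: MochizukiAbsTopIII2015, Proposition 3.2 (v) p.72] -/
theorem tfToTM_reflectsIsomorphisms : tfToTM.{u}.ReflectsIsomorphisms :=
  ⟨fun {_ _} φ _ => isIso_of_isIso_tfToTM_map φ⟩

/-! ## `𝒞_TF → 𝒞_TM` is essentially surjective onto pairs with compact Galois group -/

/-- Universe-polymorphic form of "the model `TF`-pair `(Π_k ↷ k̄)` is an MLF-Galois `TF`-pair" (Def 3.1 (ii),
via the identity isomorphism; abc-iut-L4-d045's `isMLFGaloisFieldPair_fieldPair` is the universe-`0` case).
[cite: MochizukiAbsTopIII2015, Definition 3.1 (ii) p.67] -/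
theorem ModelMLFGaloisData.isMLFGaloisFieldPair_fieldPair' (C : MLFClosure.{u}) (D : ModelMLFGaloisData C.k C.K) :
    IsMLFGaloisFieldPair D.fieldPair :=
  ⟨⟨C, D, ⟨GaloisFieldPair.Iso.refl' _⟩⟩⟩

/-- **Def 3.1 (iii) / Prop 3.2 (v), functor level: every MLF-Galois `TM`-pair with compact `Π` is isomorphic,
in `𝒞^MLF_TM`, to the pair of integers of an MLF-Galois `TF`-pair with compact `Π`** — namely of the model
`(Π_k ↷ k̄)` it is modelled on (`(Π_k ↷ 𝒪_k̄^⊳)` is the integers of `(Π_k ↷ k̄)`, `isoIntegersOfModel`).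
[cite: MochizukiAbsTopIII2015, Proposition 3.2 (v) p.72] -/
theorem exists_iso_tfToTM_obj (Q : MLFGaloisMonoidPairCat.{u} .TM) [hc : CompactSpace Q.obj.Pi] :
    ∃ P : MLFGaloisFieldPairCompactCat.{u}, Nonempty (tfToTM.obj P ≅ Q) := by
  obtain ⟨C, D, Q₀, hQ₀, ⟨e⟩⟩ := Q.property.exists_model
  have hQ' : D.tmPair = Q₀ := Option.some_injective _ (D.monoidPair_TM.symm.trans hQ₀)
  subst hQ'
  haveI : CompactSpace D.fieldPair.Pi := e.isoPi.toHomeomorph.symm.compactSpace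
  have hD : IsMLFGaloisFieldPair D.fieldPair := ModelMLFGaloisData.isMLFGaloisFieldPair_fieldPair' C D
  refine ⟨⟨D.fieldPair, hD, inferInstance⟩, ⟨ObjectProperty.isoMk _ ?_⟩⟩
  exact ((ModelMLFGaloisData.isoIntegersOfModel C D (GaloisFieldPair.Iso.refl' _) hD).symm.trans e).toCatIso

/-- The same, phrased on the essential image: an MLF-Galois `TM`-pair with compact `Π` lies in the essential
image of `𝒞^MLF_TF → 𝒞^MLF_TM`. [cite: MochizukiAbsTopIII2015, Proposition 3.2 (v) p.72] -/
theorem mem_essImage_tfToTM (Q : MLFGaloisMonoidPairCat.{u} .TM) [CompactSpace Q.obj.Pi] :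
    tfToTM.essImage Q := by
  obtain ⟨P, ⟨i⟩⟩ := exists_iso_tfToTM_obj Q
  exact ⟨P, ⟨i⟩⟩

/-- Conversely the essential image consists of pairs with compact `Π` (the functor does not change `Π`, and an
isomorphism of pairs is a homeomorphism on `Π`). [cite: MochizukiAbsTopIII2015, Definition 3.1 (iii) p.68] -/
theorem compactSpace_of_mem_essImage_tfToTM (Q : MLFGaloisMonoidPairCat.{u} .TM) (hQ : tfToTM.essImage Q) :
    CompactSpace Q.obj.Pi := by
  obtain ⟨P, ⟨i⟩⟩ := hQ
  haveI : CompactSpace (tfToTM.obj P).obj.Pi := P.property.2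
  let i' : (tfToTM.obj P).obj ≅ Q.obj :=
    ⟨i.hom.hom, i.inv.hom, congrArg InducedCategory.Hom.hom i.hom_inv_id,
      congrArg InducedCategory.Hom.hom i.inv_hom_id⟩
  exact (GaloisMonoidPair.isoOfCatIso i').isoPi.toHomeomorph.compactSpace

/-! ## `𝒞_TM → 𝒞_TLG` is faithful -/

/-- **`𝒞^MLF_TM → 𝒞^MLF_TLG` is injective on morphisms** (`M ↪ M^gp` for `M ≅ 𝒪_k̄^⊳`, `of_injective_of_TM`).
[cite: MochizukiAbsTopIII2015, Definition 3.1 (iii) p.68] -/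
theorem tmToTLG_map_injective {P Q : MLFGaloisMonoidPairCat.{u} .TM} :
    Function.Injective (tmToTLG.map : (P ⟶ Q) → (tmToTLG.obj P ⟶ tmToTLG.obj Q)) := by
  intro φ ψ h
  have h' := congrArg InducedCategory.Hom.hom h
  have hPi := congrArg GaloisMonoidPair.Hom.homPi h'
  apply InducedCategory.hom_ext
  refine GaloisMonoidPair.Hom.ext ?_ (MonoidHom.ext fun m => ?_)
  · exact hPi
  · apply GaloisMonoidPair.of_injective_of_TM Q.property
    have h1 := congrArg (fun χ : P.obj.groupification.Hom Q.obj.groupification =>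
      χ.homM (GrothendieckGroup.of m)) h'
    change gpMap (GaloisMonoidPair.Hom.homM (P := P.obj) (Q := Q.obj) φ.hom) (GrothendieckGroup.of m) =
      gpMap (GaloisMonoidPair.Hom.homM (P := P.obj) (Q := Q.obj) ψ.hom) (GrothendieckGroup.of m) at h1
    rwa [gpMap_of, gpMap_of] at h1

/-- **Def 3.1 (iii), functor level: `𝒞^MLF_TM → 𝒞^MLF_TLG` is FAITHFUL.** [cite: MochizukiAbsTopIII2015, Definition 3.1 (iii) p.68] -/
theorem tmToTLG_faithful : tmToTLG.{u}.Faithful := ⟨fun {_ _} => tmToTLG_map_injective⟩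

/-- Hence `𝒞^MLF_TF → 𝒞^MLF_TM → 𝒞^MLF_TLG` (`(Π ↷ M) ↦ (Π ↷ (𝒪^⊳)^gp)`, "`k̄^×` from `k̄`") is faithful.
[cite: MochizukiAbsTopIII2015, Definition 3.1 (iii) p.68] -/
theorem tfToTM_tmToTLG_faithful : (tfToTM.{u} ⋙ tmToTLG).Faithful :=
  haveI := tfToTM_faithful.{u}
  haveI := tmToTLG_faithful.{u}
  Functor.Faithful.comp _ _

end Literature.AnabelianGeometry.AbsoluteAnabelian

end
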